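import Literature.Probability.RandomPlanarGeometry.SAWHalfSpaceRatioRate
import Literature.Probability.RandomPlanarGeometry.SAWRatioUniform
import Mathlib.Analysis.SpecialFunctions.Pow.Real
import HarnessLib

/-!
# Half-space self-avoiding walks: the uniform ratio lemma `|μ^k h_{n-k}/h_n - 1| ≤ K(k n^{-1/4} + 1/log n)`

Topic `Literature/Probability/RandomPlanarGeometry` (continues `SAWHalfSpaceRatioRate.lean` — the two-step rate
`halfSpaceTwoStepRate_abs` and LSW (A.3) with a rate `halfSpaceRatio_rate_log` — and the model-free
`SAWRatioUniform.lean`).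

Sources: G. Lawler, O. Schramm, W. Werner, *On the scaling limit of planar self-avoiding walk* (2004),
Appendix A, (A.2)–(A.3): ratio limits for the number `h_N` of `N`-step half-space walks — no rate
[LawlerSchrammWerner2004SAW]; N. Madras, G. Slade, *The Self-Avoiding Walk* (1993), Theorem 8.3.1 (proof,
eq. (8.3.11): the shifted ratios `b_{n-k}/b_n → μ^{-k}`) — no rate, no uniformity in `k` [MadrasSlade1993].

## What is new in this file (not in print)

**`Zd.halfSpace_ratio_uniform`** — `∃ K ≥ 0, ∃ N₀, ∀ n ≥ N₀, ∀ k, k⁵ ≤ n → |μ^k h_{n-k}/h_n - 1| ≤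
K (k n^{-1/4} + 1/log n)` on every `ℤ^{d+2}`: the model-free `RatioUniform.ratio_uniform_of_rates` fed with the
tree's two rates for `h`. It is the head input of the half-space Kesten-measure rate (lane «pcv-sawmu», route
R27.6, `SAWHalfSpaceKestenRate.lean`).
-/

noncomputable section

open Finset Filter Topology
open scoped BigOperators

namespace Literature.Probability.RandomPlanarGeometry.SAW

namespace Zd

/-- **The uniform ratio lemma for half-space walks** (every `d`): `∃ K ≥ 0, ∃ N₀, ∀ n ≥ N₀, ∀ k, k⁵ ≤ n →
|μ^k h_{n-k}/h_n - 1| ≤ K (k n^{-1/4} + 1/log n)` on `ℤ^{d+2}` — the model-free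
`RatioUniform.ratio_uniform_of_rates` fed with `halfSpaceTwoStepRate_abs` and `halfSpaceRatio_rate_log`.
[cite: LawlerSchrammWerner2004SAW, Appendix (A.2)–(A.3) (quantitative form, derived); MadrasSlade1993, Theorem 8.3.1 (proof, eq. (8.3.11))] -/
theorem halfSpace_ratio_uniform (d : ℕ) :
    ∃ K : ℝ, 0 ≤ K ∧ ∃ N₀ : ℕ, ∀ n : ℕ, N₀ ≤ n → ∀ k : ℕ, k ^ 5 ≤ n →
      |connectiveConstant (d + 2) ^ k * (halfSpaceCount (d + 2) (n - k) : ℝ) / halfSpaceCount (d + 2) n - 1| ≤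
        K * ((k : ℝ) * (n : ℝ) ^ (-(1 : ℝ) / 4) + 1 / Real.log n) :=
  RatioUniform.ratio_uniform_of_rates (w := fun n => (halfSpaceCount (d + 2) n : ℝ))
    (fun n => by exact_mod_cast one_le_halfSpaceCount (d := d + 2) n) (connectiveConstant_pos (d + 2))
    (halfSpaceTwoStepRate_abs d) (halfSpaceRatio_rate_log d)

end Zd

end Literature.Probability.RandomPlanarGeometry.SAW

end
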